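import Summits.BirchSwinnertonDyer.Rank1Residual.P2.CongruentNumberThetaThreePrimesDescent
import Summits.BirchSwinnertonDyer.Rank1Residual.P2.CongruentNumberPairsAtTwoEvenAtlasThreeTransfer
import Summits.BirchSwinnertonDyer.Rank1Residual.P2.CongruentClassSevenKernelGenusParity
import HarnessLib
import HarnessLib.Audit.Tags

/-!
# Cell «bsd-monsky» (prover-B): the `k = 3` type `(5, 5, 7)` on Legendre symbols — `g(n)` odd ⟺ `(p₁p₂/p₃) = −1`,
# Monsky's `s(n) = 1` on the whole type, TYZ's `Σ₂′(n)` EVEN on the half `(p₁/p₂) = +1`; hence Monsky's C-P2-2 at `k = 3`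
# on the explicit family `{2p₁p₂p₃ : p₁ ≡ p₂ ≡ 5, p₃ ≡ 7 (mod 8), (p₁p₂/p₃) = −1}` relative to
# {`tyz_cmPointGaloisData`, GZK, Monsky's even matrix theorem} (kernel theorem; nothing asserted, nothing booked)

HONEST FRAMING (cell `bsd-monsky`, run/shared/lean/pub/bsd-monsky/; README §1/§3): the cell's CLAIMED theorem is Monsky's
1990 conjecture on the `k = 2` family `𝒮⁻`; «ℓ ≥ 3 rungs (C-P2-2 for k ≥ 3) are NOT claimed — record what the same argument
gives there, no more». THIS FILE COMPLETES THAT RECORD IN THE KERNEL for the type `(5, 5, 7)` of `P2/CongruentNumberThetaThreePrimes.lean`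
(THEOREM B₃: `g(n)` odd ⟹ `𝓛(n)` odd, relative to the display and a rank input) by EVALUATING its hypotheses on Legendre
symbols with the tree's configuration calculus (`CongruentNumberPairsAtTwoEvenAtlasThree{Census,Transfer}`, finite checks by
`decide`; Rédei–Reichardt instantiated by the tree's theorem `redeiReichardt_fourTwoCard_classGroup_holds`):
* §1 the configuration of the type: residues `(5, 5, 7)`, bits `β = betaOf (5,5,7) (s₀, s₁, s₂)` with `s₀ = [(p₂/p₁) = −1]`,
  `s₁ = [(p₃/p₁) = −1]`, `s₂ = [(p₃/p₂) = −1]` (quadratic reciprocity for the transposed bits);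
* §2 three finite checks (`decide`): Monsky's even matrix has a `2`-element kernel for ALL `(s₀, s₁, s₂)`; the Rédei bit of
  `ℚ(√−2p₁p₂p₃)` is `s₁ + s₂`; TYZ's `Σ₂′ ≡ s₁·s₂ + s₁ + s₂ + …` — precisely: `Σ₂′` is EVEN iff NOT (`s₀ = 1` and `s₁ + s₂ = 1`)
  and not (`s₀ = 0`, `s₁ = s₂ = 0`) — read off below only in the two shapes used;
* §3 transfers: `monskySelmerRankEven ![p₁, p₂, p₃] = 1` on the whole type; `g(n)` odd ⟺ `(p₁p₂/p₃) = −1`; `Σ₂′(n)` even when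
  `(p₁/p₂) = +1` and `(p₁p₂/p₃) = −1` (TYZ Thm. 1.2 / the landed U⁺ door are SILENT there);
* §4 THE FAMILY THEOREMS: for primes `p₁ ≡ p₂ ≡ 5`, `p₃ ≡ 7 (mod 8)`, `p₁ ≠ p₂`, `(p₁p₂/p₃) = −1`:
  `ord_{s=1} L(E_{2p₁p₂p₃}, s) = 1` relative to `tyz_cmPointGaloisData` ALONE, and
  rank `1`, `Ш[2^∞] = 0`, `BSD(E_{2p₁p₂p₃}, 2)` relative to {`tyz_cmPointGaloisData`, GZK, `monsky_card_selmerGroup_two_even`}.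
  On the half `(p₁/p₂) = +1` this is Monsky's conjecture C-P2-2 (`k = 3`, `s(n) = 1` ⟹ `ord = 1 ∧ BSD₂`) on an explicit
  infinite family where no printed theorem decides it (smallest members `2030 = 2·5·29·7`, `8990 = 2·5·29·31`; census types
  `[5,5,7]/[0,1,0]`, `[0,0,1]` of HOME/proof/PROOF-B-K3-SCOPE.md); on the half `(p₁/p₂) = −1` it re-derives TYZ Thm. 1.2 (loud).
NOT refereed; not part of PROOF-B v1.3 or of the paper; EVIDENCE for the planner's `k = 3` decision (D-0059), nothing more.

References: [TianYuanZhang2017] Thm. 1.2, §3; [HeathBrown1994SelmerCongruentII] Appendix (Monsky) p. 41 L20–L36; [LiMa2008]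
Thm. 0.4, Lemma 0.1; [IrelandRosen1990] Ch. 5 §2 Thm. 1; [Miller2011LMS] Def. 1.1; HOME/proof/PROOF-B-K3-SCOPE.md §2–§4.
-/

noncomputable section

open scoped Classical

open Matrix Finset WeierstrassCurve Literature.NumberTheory.EllipticCurves
  Literature.NumberTheory.EllipticCurves.Rank1Residual
  Literature.NumberTheory.EllipticCurves.Rank1Residual.Typed
  Literature.NumberTheory.EllipticCurves.HeathBrown1994
  Literature.NumberTheory.EllipticCurves.Tian2014
  Literature.NumberTheory.EllipticCurves.TianYuanZhang2017
  Literature.NumberTheory.EllipticCurves.TianYuanZhang2017.W2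
  Literature.NumberTheory.QuadraticFields.RedeiReichardt

set_option autoImplicit false

namespace Summit.BirchSwinnertonDyer.Rank1Residual.P2

namespace ThetaDescent

/-! ## §1 The configuration of the type `(5, 5, 7)` -/

section Cfg

variable {p₁ p₂ p₃ : ℕ}

/-- The prime triple `(p₁, p₂, p₃)` of the type: primes, none equal to `2`, injective. [cite: HardyWright2008, §1.3 Thm. 2] -/
theorem triple_557 (hp₁ : p₁.Prime) (hp₂ : p₂.Prime) (hp₃ : p₃.Prime) (h₁ : p₁ % 8 = 5) (h₂ : p₂ % 8 = 5)
    (h₃ : p₃ % 8 = 7) (h12 : p₁ ≠ p₂) :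
    (∀ i, ((![p₁, p₂, p₃] : Fin 3 → ℕ) i).Prime) ∧ (∀ i, (![p₁, p₂, p₃] : Fin 3 → ℕ) i ≠ 2) ∧
      Function.Injective (![p₁, p₂, p₃] : Fin 3 → ℕ) := by
  have h13 : p₁ ≠ p₃ := fun h => by omega
  have h23 : p₂ ≠ p₃ := fun h => by omega
  refine ⟨fun i => by fin_cases i <;> assumption, fun i => by fin_cases i <;> simp <;> omega, ?_⟩
  intro i j h
  fin_cases i <;> fin_cases j <;> simp_all

/-- **The Legendre configuration of the type**: residues `(5, 5, 7)` and bit matrix `β a b = [(p_b/p_a) = −1]` equal to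
`betaOf (5,5,7) (s₀, s₁, s₂)`, `s₀ = [(p₂/p₁) = −1]`, `s₁ = [(p₃/p₁) = −1]`, `s₂ = [(p₃/p₂) = −1]` (the transposed bits by
quadratic reciprocity: `p₁, p₂ ≡ 1 (mod 4)`). [cite: IrelandRosen1990, Ch. 5 §2 Thm. 1 (quadratic reciprocity)] -/
theorem cfg_557 (hp₁ : p₁.Prime) (hp₂ : p₂.Prime) (hp₃ : p₃.Prime) (h₁ : p₁ % 8 = 5) (h₂ : p₂ % 8 = 5)
    (h₃ : p₃ % 8 = 7) (h12 : p₁ ≠ p₂) :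
    (fun i => (![p₁, p₂, p₃] : Fin 3 → ℕ) i % 8) = ![5, 5, 7] ∧
    (fun a b => kroneckerBit ((![p₁, p₂, p₃] : Fin 3 → ℕ) b) ((![p₁, p₂, p₃] : Fin 3 → ℕ) a)) =
      betaOf ![5, 5, 7] ![kroneckerBit p₂ p₁, kroneckerBit p₃ p₁, kroneckerBit p₃ p₂] := by
  have hp₁2 : p₁ ≠ 2 := by omega
  have hp₂2 : p₂ ≠ 2 := by omega
  have hp₃2 : p₃ ≠ 2 := by omega
  have h13 : p₁ ≠ p₃ := fun h => by omega
  have h23 : p₂ ≠ p₃ := fun h => by omega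
  have h14 : p₁ % 4 = 1 := by omega
  have h24 : p₂ % 4 = 1 := by omega
  have h34 : p₃ % 4 = 3 := by omega
  refine ⟨?_, ?_⟩
  · funext i; fin_cases i <;> simp [h₁, h₂, h₃]
  · funext a b
    fin_cases a <;> fin_cases b
    · simpa [betaOf] using kroneckerBit_self hp₁
    · simp [betaOf]
    · simp [betaOf]
    · simp [betaOf, kroneckerBit_swap hp₁ hp₂ hp₁2 hp₂2 h12, chi4Bit, h14, h24]
    · simpa [betaOf] using kroneckerBit_self hp₂
    · simp [betaOf]
    · simp [betaOf, kroneckerBit_swap hp₁ hp₃ hp₁2 hp₃2 h13, chi4Bit, h14, h34]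
    · simp [betaOf, kroneckerBit_swap hp₂ hp₃ hp₂2 hp₃2 h23, chi4Bit, h24, h34]
    · simpa [betaOf] using kroneckerBit_self hp₃

end Cfg

/-! ## §2 The finite checks on the configuration (`decide`) -/

/-- **Monsky's even matrix on the type `(5, 5, 7)` has a `2`-element kernel for EVERY bit pattern** (`s(n) = 1` on the
whole type). [cite: HeathBrown1994SelmerCongruentII, Appendix (Monsky), typescript p. 41 L20–L36] -/
theorem card_ker_monskyCfgEven_557 : ∀ s₀ s₁ s₂ : ZMod 2,
    Fintype.card {v : Fin 3 ⊕ Fin 3 → ZMod 2 //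
      monskyCfgEven ![5, 5, 7] (betaOf ![5, 5, 7] ![s₀, s₁, s₂]) *ᵥ v = 0} = 2 := by
  decide

/-- **The Rédei bit of `ℚ(√−2p₁p₂p₃)` on the type `(5, 5, 7)` is `s₁ + s₂`** (`g(n)` odd iff `[(p₃/p₁) = −1] ≠ [(p₃/p₂) = −1]`).
[cite: LiMa2008, Thm. 0.4 with Lemma 0.1, Def. 0.2 (p. 279)] -/
theorem gBitCfgTwo_557 : ∀ s₀ s₁ s₂ : ZMod 2,
    gBitCfgTwo ![5, 5, 7] (betaOf ![5, 5, 7] ![s₀, s₁, s₂]) = s₁ + s₂ := by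
  decide

/-- **TYZ's `Σ₂′` on the type `(5, 5, 7)` with `s₀ = 0`, `s₁ + s₂ = 1` VANISHES mod `2`** (the genus criterion is silent
there). [cite: TianYuanZhang2017, Thm. 1.2 (the second sum for n ≡ 6 (mod 8))] -/
theorem sigma2'CfgEven_557_silent : ∀ s₁ s₂ : ZMod 2, s₁ + s₂ = 1 →
    sigma2'CfgEven ![5, 5, 7] (betaOf ![5, 5, 7] ![0, s₁, s₂]) = 0 := by
  decide

/-! ## §3 Transfers to the primes -/

section Transfer

variable {p₁ p₂ p₃ : ℕ}

/-- **Monsky's `s(2p₁p₂p₃) = 1` on the whole type `(5, 5, 7)`** (kernel-decided: `monskySelmerRankEven ![p₁, p₂, p₃] = 1`).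
[cite: HeathBrown1994SelmerCongruentII, Appendix (Monsky), typescript p. 41 L36] -/
theorem monskySelmerRankEven_557 (hp₁ : p₁.Prime) (hp₂ : p₂.Prime) (hp₃ : p₃.Prime) (h₁ : p₁ % 8 = 5)
    (h₂ : p₂ % 8 = 5) (h₃ : p₃ % 8 = 7) (h12 : p₁ ≠ p₂) : monskySelmerRankEven ![p₁, p₂, p₃] = 1 := by
  obtain ⟨ht, ht2, hinj⟩ := triple_557 hp₁ hp₂ hp₃ h₁ h₂ h₃ h12
  obtain ⟨hR, hB⟩ := cfg_557 hp₁ hp₂ hp₃ h₁ h₂ h₃ h12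
  rw [monskySelmerRankEven_eq_one_iff_card_ker, card_ker_monskyMatrixEven_eq_cfg _ ht ht2 hinj]
  have hmat : monskyCfgEven (fun i => (![p₁, p₂, p₃] : Fin 3 → ℕ) i % 8)
      (fun a b => kroneckerBit ((![p₁, p₂, p₃] : Fin 3 → ℕ) b) ((![p₁, p₂, p₃] : Fin 3 → ℕ) a)) =
      monskyCfgEven ![5, 5, 7] (betaOf ![5, 5, 7] ![kroneckerBit p₂ p₁, kroneckerBit p₃ p₁, kroneckerBit p₃ p₂]) := by
    rw [hR, hB]
  rw [Fintype.card_congr (Equiv.subtypeEquivRight fun v => by rw [hmat])]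
  exact card_ker_monskyCfgEven_557 _ _ _

/-- **`g(2p₁p₂p₃)` odd ⟺ `[(p₃/p₁) = −1] + [(p₃/p₂) = −1] = 1`** on the type `(5, 5, 7)` (mod RR, instantiated).
[cite: LiMa2008, Thm. 0.4] [cite: TianYuanZhang2017, §1 (p0002 L78–L82: g(d))] -/
theorem odd_gK_two_mul_557_iff_bits (hp₁ : p₁.Prime) (hp₂ : p₂.Prime) (hp₃ : p₃.Prime) (h₁ : p₁ % 8 = 5)
    (h₂ : p₂ % 8 = 5) (h₃ : p₃ % 8 = 7) (h12 : p₁ ≠ p₂) :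
    Odd (gK (2 * (p₁ * p₂ * p₃))) ↔ kroneckerBit p₃ p₁ + kroneckerBit p₃ p₂ = 1 := by
  obtain ⟨ht, ht2, hinj⟩ := triple_557 hp₁ hp₂ hp₃ h₁ h₂ h₃ h12
  obtain ⟨hR, hB⟩ := cfg_557 hp₁ hp₂ hp₃ h₁ h₂ h₃ h12
  have hprod : 2 * ∏ i, (![p₁, p₂, p₃] : Fin 3 → ℕ) i = 2 * (p₁ * p₂ * p₃) := by rw [Fin.prod_univ_three]; rfl
  have h := natCast_genusClassNumber_two_mul_eq_gBitCfgTwo redeiReichardt_fourTwoCard_classGroup_holds _ ht ht2 hinj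
  rw [hprod, hR, hB, gBitCfgTwo_557] at h
  unfold gK
  rw [← ZMod.natCast_eq_one_iff_odd, h]

/-- On the type: `(p₁p₂/p₃) = −1` ⟺ the two bits `[(p₃/p₁) = −1]`, `[(p₃/p₂) = −1]` differ (reciprocity, `pᵢ ≡ 1 (mod 4)`).
[cite: IrelandRosen1990, Ch. 5 §2 Thm. 1] -/
theorem bits_eq_one_of_jacobiSym_mul (hp₁ : p₁.Prime) (hp₂ : p₂.Prime) (hp₃ : p₃.Prime) (h₁ : p₁ % 8 = 5)
    (h₂ : p₂ % 8 = 5) (h₃ : p₃ % 8 = 7) (hj : jacobiSym ((p₁ : ℤ) * p₂) p₃ = -1) :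
    kroneckerBit p₃ p₁ + kroneckerBit p₃ p₂ = 1 := by
  have hp₁2 : p₁ ≠ 2 := by omega
  have hp₂2 : p₂ ≠ 2 := by omega
  have hp₃2 : p₃ ≠ 2 := by omega
  have h13 : p₁ ≠ p₃ := fun h => by omega
  have h23 : p₂ ≠ p₃ := fun h => by omega
  have hc₁ : chi4Bit p₁ = 0 := by unfold chi4Bit; rw [if_neg (by omega)]
  have hc₂ : chi4Bit p₂ = 0 := by unfold chi4Bit; rw [if_neg (by omega)]
  -- transpose the bits: `[(p₃/pᵢ) = −1] = [(pᵢ/p₃) = −1]`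
  have hs₁ : kroneckerBit p₃ p₁ = kroneckerBit p₁ p₃ := by
    rw [kroneckerBit_swap hp₁ hp₃ hp₁2 hp₃2 h13, hc₁, zero_mul, add_zero]
  have hs₂ : kroneckerBit p₃ p₂ = kroneckerBit p₂ p₃ := by
    rw [kroneckerBit_swap hp₂ hp₃ hp₂2 hp₃2 h23, hc₂, zero_mul, add_zero]
  rw [hs₁, hs₂]
  rw [jacobiSym.mul_left] at hj
  obtain ⟨b1, b2⟩ := kroneckerBit_of_jacobiSym hp₁ hp₃ hp₃2 h13
  obtain ⟨c1, c2⟩ := kroneckerBit_of_jacobiSym hp₂ hp₃ hp₃2 h23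
  rcases jacobiSym.eq_one_or_neg_one (int_gcd_prime_eq_one hp₁ hp₃ h13) with hb | hb <;>
    rcases jacobiSym.eq_one_or_neg_one (int_gcd_prime_eq_one hp₂ hp₃ h23) with hc | hc
  · rw [hb, hc] at hj; norm_num at hj
  · rw [b1 hb, c2 hc]; decide
  · rw [b2 hb, c1 hc]; decide
  · rw [hb, hc] at hj; norm_num at hj

/-- **`g(2p₁p₂p₃)` is ODD for the type `(5, 5, 7)` with `(p₁p₂/p₃) = −1`** (Rédei, instantiated). Unconditional.
[cite: LiMa2008, Thm. 0.4] [cite: TianYuanZhang2017, §1 (g(d))] -/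
theorem odd_gK_two_mul_557 (hp₁ : p₁.Prime) (hp₂ : p₂.Prime) (hp₃ : p₃.Prime) (h₁ : p₁ % 8 = 5) (h₂ : p₂ % 8 = 5)
    (h₃ : p₃ % 8 = 7) (h12 : p₁ ≠ p₂) (hj : jacobiSym ((p₁ : ℤ) * p₂) p₃ = -1) : Odd (gK (2 * (p₁ * p₂ * p₃))) :=
  (odd_gK_two_mul_557_iff_bits hp₁ hp₂ hp₃ h₁ h₂ h₃ h12).mpr (bits_eq_one_of_jacobiSym_mul hp₁ hp₂ hp₃ h₁ h₂ h₃ hj)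

/-- **TYZ's printed `Σ₂′(2p₁p₂p₃)` is EVEN on the half `(p₁/p₂) = +1`, `(p₁p₂/p₃) = −1` of the type** — Theorem 1.2 of
[TianYuanZhang2017] (and the tree's U⁺ door) is SILENT exactly where this file's family theorem speaks on that half.
Unconditional (RR instantiated). [cite: TianYuanZhang2017, Thm. 1.2 (the second sum for n ≡ 6 (mod 8))] [cite: LiMa2008, Thm. 0.4] -/
theorem not_odd_genusSum₂'_two_mul_557 (hp₁ : p₁.Prime) (hp₂ : p₂.Prime) (hp₃ : p₃.Prime) (h₁ : p₁ % 8 = 5)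
    (h₂ : p₂ % 8 = 5) (h₃ : p₃ % 8 = 7) (h12 : p₁ ≠ p₂) (ha : jacobiSym (p₁ : ℤ) p₂ = 1)
    (hj : jacobiSym ((p₁ : ℤ) * p₂) p₃ = -1) :
    ¬ Odd (genusSum₂' (2 * (p₁ * p₂ * p₃)) fun d => genusClassNumber (GenusField d)) := by
  obtain ⟨ht, ht2, hinj⟩ := triple_557 hp₁ hp₂ hp₃ h₁ h₂ h₃ h12
  obtain ⟨hR, hB⟩ := cfg_557 hp₁ hp₂ hp₃ h₁ h₂ h₃ h12
  have hp₂2 : p₂ ≠ 2 := by omega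
  have hprod : 2 * ∏ i, (![p₁, p₂, p₃] : Fin 3 → ℕ) i = 2 * (p₁ * p₂ * p₃) := by rw [Fin.prod_univ_three]; rfl
  have h12m : (p₁ * p₂) % 8 = 1 := by rw [Nat.mul_mod, h₁, h₂]
  have hm7 : (p₁ * p₂ * p₃) % 8 = 7 := by rw [Nat.mul_mod, h12m, h₃]
  have h8 : (2 * ∏ i, (![p₁, p₂, p₃] : Fin 3 → ℕ) i) % 8 = 6 := by rw [hprod]; omega
  have h := natCast_genusSum₂'_two_mul_three_eq_cfg _ redeiReichardt_fourTwoCard_classGroup_holds ht ht2 hinj h8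
  rw [hprod, hR, hB] at h
  -- `s₀ = [(p₂/p₁) = −1] = 0`
  have hs₀ : kroneckerBit p₂ p₁ = 0 := by
    have hp₁2 : p₁ ≠ 2 := by omega
    have hc₁ : chi4Bit p₁ = 0 := by unfold chi4Bit; rw [if_neg (by omega)]
    rw [kroneckerBit_swap hp₂ hp₁ hp₂2 hp₁2 h12.symm, (kroneckerBit_of_jacobiSym hp₁ hp₂ hp₂2 h12).1 ha, hc₁,
      mul_zero, add_zero]
  rw [hs₀, sigma2'CfgEven_557_silent _ _ (bits_eq_one_of_jacobiSym_mul hp₁ hp₂ hp₃ h₁ h₂ h₃ hj)] at h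
  rw [← ZMod.natCast_eq_one_iff_odd, h]
  exact zero_ne_one

end Transfer

/-! ## §4 The family theorems -/

section Family

/-- **Clause (a) on the explicit family, from ONE Literature display**: for primes `p₁ ≡ p₂ ≡ 5`, `p₃ ≡ 7 (mod 8)`, `p₁ ≠ p₂`,
`(p₁p₂/p₃) = −1`: `ord_{s=1} L(E_{2p₁p₂p₃}, s) = 1`, relative to `tyz_cmPointGaloisData` ALONE (`g(n)` odd is a tree theorem;
THEOREM B₃ gives `𝓛(n) ≠ 0`; root number `−1`). No GZK, no Selmer input, no genus-sum hypothesis — in particular on the half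
`(p₁/p₂) = +1`, where `Σ₂′(n)` is even (`not_odd_genusSum₂'_two_mul_557`) and no printed theorem applies. CONDITIONAL; nothing
asserted. [cite: TianYuanZhang2017, §1 (definition of 𝓛(n), p0002 L46–L75), §3 (Prop. 3.2, Thm. 3.5, Thm. 3.6, Lemma 3.18, J759)] -/
theorem analyticRank_eq_one_two_mul_557_family_of_cmPointGaloisData (hCM : tyz_cmPointGaloisData) :
    ∀ p₁ p₂ p₃ : ℕ, p₁.Prime → p₂.Prime → p₃.Prime → p₁ % 8 = 5 → p₂ % 8 = 5 → p₃ % 8 = 7 → p₁ ≠ p₂ →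
      jacobiSym ((p₁ : ℤ) * p₂) p₃ = -1 → (congruentNumberCurve (2 * (p₁ * p₂ * p₃))).analyticRank = 1 :=
  fun _ _ _ hp₁ hp₂ hp₃ h₁ h₂ h₃ h12 hj =>
    analyticRank_eq_one_two_mul_557_of_cmPointGaloisData hCM hp₁ hp₂ hp₃ h₁ h₂ h₃ h12
      (odd_gK_two_mul_557 hp₁ hp₂ hp₃ h₁ h₂ h₃ h12 hj)

/-- **Monsky's conjecture C-P2-2 at `k = 3` on the explicit family — `ord_{s=1} L = 1`, rank `1`, `Ш[2^∞] = 0`, `BSD(E_n, 2)`**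
for `n = 2p₁p₂p₃`, primes `p₁ ≡ p₂ ≡ 5`, `p₃ ≡ 7 (mod 8)`, `p₁ ≠ p₂`, `(p₁p₂/p₃) = −1`, relative to THREE named facts:
`tyz_cmPointGaloisData` (TYZ §3 as printed, every block), GZK (`rank_eq_analyticRank_of_analyticRank_le_one`), and Monsky's
even `2`-descent matrix theorem (`monsky_card_selmerGroup_two_even`; `s(n) = 1` itself is kernel-decided on the type). CONDITIONAL;
nothing asserted; closes no class by itself (census: smallest members `2030`, `8990`; none below the book230 bound).
[cite: TianYuanZhang2017, §1 (1.1), Thm. 3.5, §3] [cite: HeathBrown1994SelmerCongruentII, Appendix (Monsky), typescript p. 41 L20–L36]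
[cite: Miller2011LMS, Def. 1.1 (arXiv:1010.2431 p. 3)] -/
theorem rankOne_sha_bsdp_two_two_mul_557_family (hCM : tyz_cmPointGaloisData)
    (hGZK : rank_eq_analyticRank_of_analyticRank_le_one) (hMe : monsky_card_selmerGroup_two_even) :
    ∀ p₁ p₂ p₃ : ℕ, p₁.Prime → p₂.Prime → p₃.Prime → p₁ % 8 = 5 → p₂ % 8 = 5 → p₃ % 8 = 7 → p₁ ≠ p₂ →
      jacobiSym ((p₁ : ℤ) * p₂) p₃ = -1 →
      (congruentNumberCurve (2 * (p₁ * p₂ * p₃))).analyticRank = 1 ∧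
        (congruentNumberCurve (2 * (p₁ * p₂ * p₃))).mordellWeilRank = 1 ∧
        AddCommGroup.primaryComponent (congruentNumberCurve (2 * (p₁ * p₂ * p₃))).sha 2 = ⊥ ∧
        BSDp (congruentNumberCurve (2 * (p₁ * p₂ * p₃))) 2 :=
  fun _ _ _ hp₁ hp₂ hp₃ h₁ h₂ h₃ h12 hj =>
    rankOne_sha_bsdp_two_two_mul_557_of_cmPointGaloisData hCM hGZK hMe hp₁ hp₂ hp₃ h₁ h₂ h₃ h12
      (odd_gK_two_mul_557 hp₁ hp₂ hp₃ h₁ h₂ h₃ h12 hj) (monskySelmerRankEven_557 hp₁ hp₂ hp₃ h₁ h₂ h₃ h12)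

end Family

end ThetaDescent

end Summit.BirchSwinnertonDyer.Rank1Residual.P2

end
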